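import Mathlib
import HarnessLib

/-!
# Route `KLProgramme` — crux K3 ENGINE (stmt-HubbardSuperconductivity-20437), stub (e) proof-input «(e)-D-ROWS»: THE SOURCE TERM OF THE (Db) `hstep` ROW IN UNITS
# (seat hubbard-kl-k3c4-p1 g24, VL lane; pure real algebra; DROWS-SCOPE-g24 v10 §12.1/§12.3 — `src k q := SRC/(cW^{2q}·u^q·Kc)`)

The source term of the (Db) row (`…TwoVolumeLipBornDiffHstep`, from `…LipChainRows.lipSourceTransfer_le_of_scaleWtRows`) is
`SRC = cWⁿ(cW·Es + τ·NDs) + (2cWⁿτN + n·cWⁿ(5τN + 2cW·N_far))`, `n + 1 = 2q`, `τ = cW/(1+Λ_T(r+1)) ≤ cW·t`, with the coarse born profile `N`, its `r`-far part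
`N_far`, the global source-defect profile `NDs` and the deep one `Es`.  Dividing by the born unit `cW^{2q}·U` (`U = u^q·Kc`) and bounding each profile in that unit
(`Es ≤ L_E·U`, `NDs ≤ L_D·U`, `N ≤ L_N·U`, `N_far ≤ L_F·U` — one-volume data, the named-data ledger's N6/N7):
`SRC/(cW^{2q}U) ≤ L_E + t·L_D + (2 + 5n)·t·L_N + 2n·L_F` — the source array `src k q` of `EngineV8.towerBornDiff_le_law_of_profile_tok` before its law reading
(`L_E`, `t`, `L_F` carry the depth gains of block `k`; the factor `n = 2q−1 ≤ 2^q` goes into `Q`).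

* **`lipSrc_div_le`** — the displayed inequality.

Pure real algebra; nothing about the model is asserted.
-/

namespace Summit.HubbardSuperconductivity.HubbardSuperconductivity.Theorems.TwoVolumeLip

set_option linter.dupNamespace false -- summit = problem name (single-conjunct summit), D-0017

/-- **The source term of the (Db) row divided by the born unit.**  `n + 1 = 2q`, `0 < cW`, `0 < U`, `τ ≤ cW·t`, `NDs, N ≥ 0`, profiles bounded in the unit `U`. -/
theorem lipSrc_div_le {n q : ℕ} (hq : 2 * q = n + 1) {cW τ t U Es NDs N Nfar LE LD LN LF : ℝ} (hcW : 0 < cW) (hU : 0 < U) (ht : 0 ≤ t)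
    (hτ : τ ≤ cW * t) (hNDs0 : 0 ≤ NDs) (hN0 : 0 ≤ N)
    (hEs : Es ≤ LE * U) (hNDs : NDs ≤ LD * U) (hN : N ≤ LN * U) (hNfar : Nfar ≤ LF * U) :
    (cW ^ n * (cW * Es + τ * NDs) + (2 * cW ^ n * τ * N + n * cW ^ n * (5 * τ * N + 2 * cW * Nfar))) / (cW ^ (2 * q) * U) ≤
      LE + t * LD + (2 + 5 * n) * t * LN + 2 * n * LF := by
  have hcWn : 0 ≤ cW ^ n := pow_nonneg hcW.le n
  have hn0 : (0 : ℝ) ≤ n := Nat.cast_nonneg n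
  have hpow : cW ^ (2 * q) = cW ^ n * cW := by rw [hq, pow_succ]
  -- replace `τ` by `cW·t`
  have h1 : cW ^ n * (cW * Es + τ * NDs) + (2 * cW ^ n * τ * N + n * cW ^ n * (5 * τ * N + 2 * cW * Nfar)) ≤
      cW ^ n * cW * (Es + t * NDs + (2 + 5 * n) * t * N + 2 * n * Nfar) := by
    have e1 : τ * NDs ≤ cW * t * NDs := mul_le_mul_of_nonneg_right hτ hNDs0
    have e2 : τ * N ≤ cW * t * N := mul_le_mul_of_nonneg_right hτ hN0
    nlinarith [mul_le_mul_of_nonneg_left e1 hcWn, mul_le_mul_of_nonneg_left e2 hcWn, mul_le_mul_of_nonneg_left e2 (mul_nonneg hn0 hcWn)]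
  -- bound the profiles in the unit
  have h2 : Es + t * NDs + (2 + 5 * n) * t * N + 2 * n * Nfar ≤ (LE + t * LD + (2 + 5 * n) * t * LN + 2 * n * LF) * U := by
    have e3 : t * NDs ≤ t * (LD * U) := mul_le_mul_of_nonneg_left hNDs ht
    have e4 : (2 + 5 * n) * t * N ≤ (2 + 5 * n) * t * (LN * U) := mul_le_mul_of_nonneg_left hN (by positivity)
    have e5 : 2 * n * Nfar ≤ 2 * n * (LF * U) := mul_le_mul_of_nonneg_left hNfar (by positivity)
    nlinarith [e3, e4, e5, hEs]
  rw [div_le_iff₀ (by positivity), hpow]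
  calc cW ^ n * (cW * Es + τ * NDs) + (2 * cW ^ n * τ * N + n * cW ^ n * (5 * τ * N + 2 * cW * Nfar))
      ≤ cW ^ n * cW * (Es + t * NDs + (2 + 5 * n) * t * N + 2 * n * Nfar) := h1
    _ ≤ cW ^ n * cW * ((LE + t * LD + (2 + 5 * n) * t * LN + 2 * n * LF) * U) :=
        mul_le_mul_of_nonneg_left h2 (mul_nonneg hcWn hcW.le)
    _ = (LE + t * LD + (2 + 5 * n) * t * LN + 2 * n * LF) * (cW ^ n * cW * U) := by ring

end Summit.HubbardSuperconductivity.HubbardSuperconductivity.Theorems.TwoVolumeLip
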